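import Mathlib
import Summits.ValiantsHypothesis.ValiantsHypothesis.Theorems.NewtonUnitEquationsNewtonTauWeakK13Laurent

/-!
# `NewtonTauWeak` (stmt-ValiantsHypothesis-5904), stub `fixedKCoincidence_t2_K3` (siege k13): conic and heavy
# Laurent polynomials

Support file of siege k13 (after `…K13Laurent`).  Closure properties of the predicates `Conic w x` (support on
the origin and on points of positive `w`-weight — unit products at a corner) and `Heavy w Ω x` (support of weight
`≥ Ω` — truncation remainders) under sums, scalars, products and shifts; first points of conic multiples
(`Conic.isFirst_mul`: a conic factor with nonzero constant term does not move the `w`-initial exponent), and the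
TRANSFER LEMMA `isFirst_of_conic_mul_eq`: if `u * G = c • F + H` with `u` conic, `u₀ ≠ 0`, `c ≠ 0` and `H` heavy
above the first point `v` of `F`, then `v` is the first point of `G` (truncated division at a three-fold corner).
No definitions. [folklore]
-/

-- the namespace mandated for this Theorems file repeats the component `ValiantsHypothesis`
set_option linter.dupNamespace false

noncomputable section

open scoped BigOperators
open AddMonoidAlgebra

namespace Summit.ValiantsHypothesis.ValiantsHypothesis.Theorems.NewtonTauWeakSiegeK13

open Summit.ValiantsHypothesis.ValiantsHypothesis.Theorems.NewtonTauWeakCorner (wt wt_add wt_zero wt_zsmul)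

variable {w : Fin 2 → ℝ}

/-! ## Conic and heavy elements -/

/-- Conic elements are heavy above `0`. [folklore] -/
theorem Conic.heavy_zero {x : L} (h : Conic w x) : Heavy w 0 x := by
  intro z hz
  rcases h z hz with rfl | hpos
  · rw [wt_zero]
  · exact hpos.le

/-- `1` is conic. [folklore] -/
theorem conic_one : Conic w (1 : L) := by
  intro z hz
  rw [coeff_one_apply] at hz
  by_cases h : (0 : Fin 2 → ℤ) = z
  · exact Or.inl h.symm
  · rw [if_neg h] at hz
    exact absurd rfl hz

/-- A monomial of positive weight (or the origin) is conic. [folklore] -/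
theorem conic_T {a : Fin 2 → ℤ} (ha : a = 0 ∨ 0 < wt w a) : Conic w (T a) := by
  intro z hz
  rw [coeff_T] at hz
  by_cases h : a = z
  · subst h; exact ha
  · rw [if_neg h] at hz
    exact absurd rfl hz

/-- Sums of conic elements are conic. [folklore] -/
theorem Conic.add {x y : L} (hx : Conic w x) (hy : Conic w y) : Conic w (x + y) := by
  intro z hz
  rw [coeff_add_apply] at hz
  by_cases h : x.coeff z = 0
  · rw [h, zero_add] at hz
    exact hy z hz
  · exact hx z h

/-- Scalar multiples of conic elements are conic. [folklore] -/
theorem Conic.smul {x : L} (hx : Conic w x) (c : ℂ) : Conic w (c • x) := by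
  intro z hz
  rw [coeff_smul_apply] at hz
  exact hx z (right_ne_zero_of_mul hz)

/-- Products of conic elements are conic. [folklore] -/
theorem Conic.mul {x y : L} (hx : Conic w x) (hy : Conic w y) : Conic w (x * y) := by
  intro z hz
  obtain ⟨a, b, rfl, ha, hb⟩ := exists_of_coeff_mul_ne_zero hz
  rcases hx a ha with rfl | hapos
  · rw [zero_add]; exact hy b hb
  · rcases hy b hb with rfl | hbpos
    · rw [add_zero]; exact Or.inr hapos
    · right; rw [wt_add]; linarith

/-- Finite products of conic elements are conic. [folklore] -/
theorem conic_prod {ι : Type*} (s : Finset ι) (f : ι → L) (hf : ∀ i ∈ s, Conic w (f i)) :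
    Conic w (∏ i ∈ s, f i) := by
  classical
  induction s using Finset.induction_on with
  | empty => rw [Finset.prod_empty]; exact conic_one
  | insert a s ha ih =>
    rw [Finset.prod_insert ha]
    exact (hf a (Finset.mem_insert_self a s)).mul (ih fun i hi => hf i (Finset.mem_insert_of_mem hi))

/-- Finite sums of conic elements are conic. [folklore] -/
theorem conic_sum {ι : Type*} (s : Finset ι) (f : ι → L) (hf : ∀ i ∈ s, Conic w (f i)) :
    Conic w (∑ i ∈ s, f i) := by
  classical
  induction s using Finset.induction_on with
  | empty => rw [Finset.sum_empty]; intro z hz; exact absurd rfl hz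
  | insert a s ha ih =>
    rw [Finset.sum_insert ha]
    exact (hf a (Finset.mem_insert_self a s)).add (ih fun i hi => hf i (Finset.mem_insert_of_mem hi))

/-- The only weightless support point of a conic element is the origin. [folklore] -/
theorem Conic.eq_zero_of_wt_le {x : L} (hx : Conic w x) {z : Fin 2 → ℤ} (hz : x.coeff z ≠ 0)
    (hle : wt w z ≤ 0) : z = 0 := by
  rcases hx z hz with h | h
  · exact h
  · exact absurd hle (not_le.mpr h)

/-- Sums of heavy elements are heavy. [folklore] -/
theorem Heavy.add {x y : L} {Ω : ℝ} (hx : Heavy w Ω x) (hy : Heavy w Ω y) : Heavy w Ω (x + y) := by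
  intro z hz
  rw [coeff_add_apply] at hz
  by_cases h : x.coeff z = 0
  · rw [h, zero_add] at hz
    exact hy z hz
  · exact hx z h

/-- Scalar multiples of heavy elements are heavy. [folklore] -/
theorem Heavy.smul {x : L} {Ω : ℝ} (hx : Heavy w Ω x) (c : ℂ) : Heavy w Ω (c • x) := by
  intro z hz
  rw [coeff_smul_apply] at hz
  exact hx z (right_ne_zero_of_mul hz)

/-- Finite sums of heavy elements are heavy. [folklore] -/
theorem heavy_sum {ι : Type*} (s : Finset ι) (f : ι → L) {Ω : ℝ} (hf : ∀ i ∈ s, Heavy w Ω (f i)) :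
    Heavy w Ω (∑ i ∈ s, f i) := by
  classical
  induction s using Finset.induction_on with
  | empty => rw [Finset.sum_empty]; intro z hz; exact absurd rfl hz
  | insert a s ha ih =>
    rw [Finset.sum_insert ha]
    exact (hf a (Finset.mem_insert_self a s)).add (ih fun i hi => hf i (Finset.mem_insert_of_mem hi))

/-- Products of heavy elements add thresholds. [folklore] -/
theorem Heavy.mul {x y : L} {Ω Ω' : ℝ} (hx : Heavy w Ω x) (hy : Heavy w Ω' y) : Heavy w (Ω + Ω') (x * y) := by
  intro z hz
  obtain ⟨a, b, rfl, ha, hb⟩ := exists_of_coeff_mul_ne_zero hz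
  rw [wt_add]
  exact add_le_add (hx a ha) (hy b hb)

/-- A conic multiple of a heavy element is heavy with the same threshold. [folklore] -/
theorem Conic.mul_heavy {u y : L} {Ω : ℝ} (hu : Conic w u) (hy : Heavy w Ω y) : Heavy w Ω (u * y) := by
  have := hu.heavy_zero.mul hy
  rwa [zero_add] at this

/-- A shift of a conic element is heavy above the weight of the shift. [folklore] -/
theorem Conic.heavy_T_mul {x : L} (hx : Conic w x) (a : Fin 2 → ℤ) : Heavy w (wt w a) (T a * x) := by
  intro z hz
  rw [coeff_T_mul] at hz
  have := hx.heavy_zero (z - a) hz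
  rw [show z = a + (z - a) by abel, wt_add]
  linarith

/-- Heaviness is monotone in the threshold. [folklore] -/
theorem Heavy.mono {x : L} {Ω Ω' : ℝ} (h : Heavy w Ω x) (hle : Ω' ≤ Ω) : Heavy w Ω' x :=
  fun z hz => hle.trans (h z hz)

/-- The zero element is heavy above every threshold. [folklore] -/
theorem heavy_zero_elem (Ω : ℝ) : Heavy w Ω (0 : L) := fun _ hz => absurd rfl hz

/-- **Perturbed products.** A product of conic elements perturbed by heavy junk is the product plus heavy junk
(nonnegative threshold). [folklore] -/
theorem prod_add_heavy {ι : Type*} (s : Finset ι) (x h : ι → L) {Ω : ℝ} (hΩ : 0 ≤ Ω)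
    (hx : ∀ i ∈ s, Conic w (x i)) (hh : ∀ i ∈ s, Heavy w Ω (h i)) :
    ∃ H : L, Heavy w Ω H ∧ ∏ i ∈ s, (x i + h i) = ∏ i ∈ s, x i + H := by
  classical
  induction s using Finset.induction_on with
  | empty => exact ⟨0, heavy_zero_elem Ω, by simp⟩
  | insert a s ha ih =>
    obtain ⟨H, hH, hprod⟩ := ih (fun i hi => hx i (Finset.mem_insert_of_mem hi))
      (fun i hi => hh i (Finset.mem_insert_of_mem hi))
    have hxa := hx a (Finset.mem_insert_self a s)
    have hha := hh a (Finset.mem_insert_self a s)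
    have hP : Conic w (∏ i ∈ s, x i) := conic_prod s x fun i hi => hx i (Finset.mem_insert_of_mem hi)
    refine ⟨x a * H + h a * ∏ i ∈ s, x i + h a * H, ?_, ?_⟩
    · refine ((hxa.mul_heavy hH).add ?_).add ?_
      · have := hha.mul hP.heavy_zero
        rwa [add_zero] at this
      · exact (hha.mul hH).mono (by linarith)
    · rw [Finset.prod_insert ha, Finset.prod_insert ha, hprod]; ring

/-! ## First points of conic multiples; the transfer lemma -/

/-- **Conic multiples.** If `u` is conic then `u * y` agrees with `u₀ · y` at the first point of `y` and vanishes
strictly below it. [folklore] -/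
theorem Conic.coeff_mul_of_isFirst {u y : L} {v : Fin 2 → ℤ} (hu : Conic w u) (hy : IsFirst w y v) :
    (u * y).coeff v = u.coeff 0 * y.coeff v ∧ ∀ z, wt w z < wt w v → (u * y).coeff z = 0 := by
  constructor
  · rw [coeff_mul_eq_sum, Finset.sum_eq_single v]
    · rw [sub_self]
    · intro b hb hbv
      have hlt : wt w v < wt w b := hy.2 b (Finsupp.mem_support_iff.mp hb) hbv
      have : u.coeff (v - b) = 0 := by
        by_contra hne
        have h0 := hu.eq_zero_of_wt_le hne (by rw [wt_sub']; linarith)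
        rw [sub_eq_zero] at h0
        exact hbv h0.symm
      rw [this, zero_mul]
    · intro hv
      rw [Finsupp.notMem_support_iff.mp hv, mul_zero]
  · intro z hz
    rw [coeff_mul_eq_sum]
    refine Finset.sum_eq_zero fun b hb => ?_
    have hle : wt w v ≤ wt w b := hy.le_of_coeff_ne_zero (Finsupp.mem_support_iff.mp hb)
    have : u.coeff (z - b) = 0 := by
      by_contra hne
      have h0 := hu.heavy_zero (z - b) hne
      rw [wt_sub'] at h0
      linarith
    rw [this, zero_mul]

/-- A conic element with nonzero constant term does not move first points. [folklore] -/
theorem Conic.isFirst_mul {u y : L} {v : Fin 2 → ℤ} (hu : Conic w u) (hu0 : u.coeff 0 ≠ 0)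
    (hy : IsFirst w y v) : IsFirst w (u * y) v := by
  obtain ⟨hval, hbelow⟩ := hu.coeff_mul_of_isFirst hy
  refine isFirst_of_forall_le (by rw [hval]; exact mul_ne_zero hu0 hy.1) fun z hzv hle => ?_
  rcases lt_or_eq_of_le hle with hlt | heq
  · exact hbelow z hlt
  · -- equal weight, different point: the coefficient of `u * y` there vanishes as well
    rw [coeff_mul_eq_sum]
    refine Finset.sum_eq_zero fun b hb => ?_
    have hb' : y.coeff b ≠ 0 := Finsupp.mem_support_iff.mp hb
    by_cases hbv : b = v
    · subst hbv
      have : u.coeff (z - b) = 0 := by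
        by_contra hne
        have h0 := hu.eq_zero_of_wt_le hne (by rw [wt_sub', heq, sub_self])
        rw [sub_eq_zero] at h0
        exact hzv h0
      rw [this, zero_mul]
    · have hlt : wt w v < wt w b := hy.2 b hb' hbv
      have : u.coeff (z - b) = 0 := by
        by_contra hne
        have h0 := hu.heavy_zero (z - b) hne
        rw [wt_sub'] at h0
        linarith
      rw [this, zero_mul]

/-- **Transfer lemma (truncated division).** Let `u` be conic with `u₀ ≠ 0`, let `v` be the first point of `F`,
and suppose `u * G = c • F + H` with `c ≠ 0` and `H` heavy above some `Ω > wt v`.  Then `v` is the first point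
of `G`. [folklore] -/
theorem isFirst_of_conic_mul_eq (hgen : Function.Injective (wt w)) {u G F H : L} {v : Fin 2 → ℤ} {c : ℂ}
    {Ω : ℝ} (hu : Conic w u) (hu0 : u.coeff 0 ≠ 0) (hF : IsFirst w F v) (hH : Heavy w Ω H) (hΩ : wt w v < Ω)
    (hc : c ≠ 0) (heq : u * G = c • F + H) : IsFirst w G v := by
  have hRHS : IsFirst w (c • F + H) v := ((isFirst_smul_iff hc F v).mpr hF).add_heavy hH hΩ
  have hG : G ≠ 0 := by
    rintro rfl
    rw [mul_zero] at heq
    exact hRHS.1 (by rw [← heq]; rfl)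
  obtain ⟨z, hz⟩ := exists_isFirst hgen hG
  have huG : IsFirst w (u * G) z := hu.isFirst_mul hu0 hz
  rw [heq] at huG
  rwa [huG.unique hRHS] at hz

end Summit.ValiantsHypothesis.ValiantsHypothesis.Theorems.NewtonTauWeakSiegeK13

end
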